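import Summits.CriticalPhenomena.PercolationContinuityZ3.Theorems.PercNearOneGluingNoHeavyQuantTwoBlobTopFlippedLightHeavy
import Summits.CriticalPhenomena.PercolationContinuityZ3.Theorems.PercNearOneGluingNoHeavyQuantTwoLowGreedy
import HarnessLib

/-!
# QUANT lane R8, T-DEC, leg (III) / PM⁻ TRANSPORT CELL, part 2: the four-atom piece `0, a, h, h+a` with TWO LOW ATOMS (`0` and `a`) —
# DEC at a prescribed floor/target/layer from an explicit flow (lows `0`, `a` into the absorbers `h`, `h + a`)

builds on p205010 (kernel theorem, internal audit signed; external expert review pending)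

Support file (`--supports stmt-CriticalPhenomena-4575`), QUANT lane seat prim-quant-arm-1 (gen 38), rung R8 of
`run/shared/lean/prim/quant/LADDER.md`; companion of `…QuantTwoBlobGateCell` (the single-low cell).  Memo
`run/shared/lean/prim/quant/prim-quant-arm-1-g38/PM-TRANSPORT-CELL-G38.md` §3 (3.2), §6.3.  Theorems only, standard axioms, no sorries, no definitions.

THE CELL.  The PM⁻ zero piece `Π = m₀δ₀ + m_aδ_a + m_hδ_h + m_tδ_{h+a}` (masses free: θ-form `m₀ = (1−γ)(1 − g(1−θ))`, `m_a = (1−γ)g(1−θ)`, `m_h = γ(1−g)`,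
`m_t = γg`; two-budget form `(1−γ)(1−g) + u`, `(1−γ)g − v`, …) at a prescribed `(y, t, j)` at which the blob atom `a` is LOW (`2a < t`, `a ≤ j`; then `a < h`
in the PM⁻ setting) and `h` is self-sufficient (`t ≤ 2h` or `h ≥ j+1`): two low atoms `0 < a`, two absorbers `h < h + a`.  By the flow normal form
(`LawDec.decAtT_of_flowAtT`, typer g22) DEC follows from four flows `F₀ₕ, F₀ₜ, F_ah, F_at ≥ 0` with row sums `m₀`, `m_a`, supported on compatible pairs, loading
`h` and `h + a` by at most their masses at the usage rates.  The CLOSED FORM of the admissible region (memo §3 (3.2)): with the Monge order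
`κ_h = usage(a,h)/usage(0,h) ≤ κ_{h+a}` (`LawDec.usage_monge`, lead g21) the flows exist iff the breakpoint inequalities of census-1's
`LawDec.twoLow_greedy_flows` hold — (kG) `m₀ + m_a ≤ a₂(h) + a₂(h+a)`, (kh) `m₀ ≤ (a₂(h) − m_a)κ_h + a₁(h+a)`, (kt) `m₀ ≤ (a₂(h) + a₂(h+a) − m_a)κ_{h+a}`
(`aᵢ(k) = m_k/usage(lowᵢ, k)`, a giant `k ≥ j+1` has `usage = y/(1−y)` for both lows) — exact check `code/breakpoints.py`: = LP on 4 000/4 000 random two-low cells.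
In the census of the memo (28 239 cells at the recommended datum) two-low cells with a giant absorber (LLGG 620, LLMG 305) always admit the full gate-zero share
(θ^max = 1) and LLMM binds in 25/130.
* **`LawDec.fourAtom_decAtT_twoLow_of_flow`** — the statement above.
* **`LawDec.fourAtom_decAtT_twoLow_mids`** (`LLMM`: `h + a ≤ j`), **`…_giantTop`** (`LLMG`: `h ≤ j < h + a`), **`…_giants`** (`LLGG`: `j + 1 ≤ h`) — the closed forms:
  the breakpoint inequalities (via `LawDec.twoLow_greedy_flows`) resp. the pool inequality `u_y(m₀ + m_a) ≤ m_h + m_t` ⟹ `DECAtT`.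

[this work]; DEC rules ARCH-TREES-G49 §2.2 / DEC-TAMP-G50 §3.1, flow normal form `…QuantLawDecFlows(Decomposition)` (typer g22), `…QuantTwoBlobZeroFlow` (typer g23,
the pattern of this proof) — this lane.  Nothing here is cited as a published result.  The gluing rows served [cite: KozmaNitzan2024, Conjecture 3 (p. 15)];
product measure [cite: Grimmett1999, §1.3 p. 10].
-/

noncomputable section

namespace Summit.CriticalPhenomena.PercolationContinuityZ3.Theorems

namespace Quant

open Finset

/-- the four-atom law `m₀δ₀ + m_a δ_a + m_h δ_h + m_t δ_{h+a}` evaluated at `k` (as in `…QuantTwoBlobGateCell`) -/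
local notation3 "ATOM4[" a ", " h ", " m0 ", " ma ", " mh ", " mt ", " k "]" =>
  (m0 : ℝ) * (if (k : ℕ) = 0 then (1 : ℝ) else 0) + (ma : ℝ) * (if (k : ℕ) = (a : ℕ) then (1 : ℝ) else 0)
    + (mh : ℝ) * (if (k : ℕ) = (h : ℕ) then (1 : ℝ) else 0) + (mt : ℝ) * (if (k : ℕ) = (h : ℕ) + (a : ℕ) then (1 : ℝ) else 0)

namespace LawDec

/-- **THE TWO-LOW FOUR-ATOM CELL FROM AN EXPLICIT FLOW.**  Law `Π = m₀δ₀ + m_aδ_a + m_hδ_h + m_tδ_{h+a}` of total `1` (nonnegativity is implied by the flow); floor `0 < y < 1`, target `t`,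
layer `j`; `1 ≤ a < h`, `a ≤ j`, `2a < t` (so `0` and `a` are the low atoms) and `h` self-sufficient (`t ≤ 2h ∨ j+1 ≤ h`).  Flows `F₀ₕ, F₀ₜ, F_ah, F_at ≥ 0` with
`F₀ₕ + F₀ₜ = m₀`, `F_ah + F_at = m_a`, each positive flow on a compatible pair (`h ≥ j+1` or `t < low + h`, resp. for `h + a`), and the loads
`usage(0,h)F₀ₕ + usage(a,h)F_ah ≤ m_h`, `usage(0,h+a)F₀ₜ + usage(a,h+a)F_at ≤ m_t` ⟹ `DECAtT y t j (h + a) Π`. [this work] -/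
theorem fourAtom_decAtT_twoLow_of_flow (y t m0 ma mh mt F0h F0t Fah Fat : ℝ) (j a h : ℕ) (hy0 : 0 < y) (hy1 : y < 1)
    (hsum : m0 + ma + mh + mt = 1)
    (ha : 1 ≤ a) (hah : a < h) (haj : a ≤ j) (halow : 2 * (a : ℝ) < t) (hhS : t ≤ 2 * (h : ℝ) ∨ j + 1 ≤ h)
    (hF0h : 0 ≤ F0h) (hF0t : 0 ≤ F0t) (hFah : 0 ≤ Fah) (hFat : 0 ≤ Fat)
    (hrow0 : F0h + F0t = m0) (hrowa : Fah + Fat = ma)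
    (hs0h : 0 < F0h → j + 1 ≤ h ∨ t < (h : ℝ)) (hs0t : 0 < F0t → j + 1 ≤ h + a ∨ t < (h : ℝ) + a)
    (hsah : 0 < Fah → j + 1 ≤ h ∨ t < (a : ℝ) + h) (hsat : 0 < Fat → j + 1 ≤ h + a ∨ t < (a : ℝ) + ((h : ℝ) + a))
    (hloadh : usage y t j 0 h * F0h + usage y t j a h * Fah ≤ mh)
    (hloadt : usage y t j 0 (h + a) * F0t + usage y t j a (h + a) * Fat ≤ mt) :
    DECAtT y t j (h + a) (fun k => ATOM4[a, h, m0, ma, mh, mt, k]) := by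
  classical
  have ind_nn : ∀ (P : Prop) [Decidable P], (0:ℝ) ≤ (if P then (1:ℝ) else 0) := fun P _ => by split_ifs <;> norm_num
  have ht0 : 0 < t := by linarith [(Nat.cast_nonneg a : (0:ℝ) ≤ a)]
  -- the flow: rows `0` and `a`, columns `h` and `h + a`
  set f : ℕ → ℕ → ℝ := fun l k =>
    (if l = 0 then (1:ℝ) else 0) * (F0h * (if k = h then (1:ℝ) else 0) + F0t * (if k = h + a then (1:ℝ) else 0))
      + (if l = a then (1:ℝ) else 0) * (Fah * (if k = h then (1:ℝ) else 0) + Fat * (if k = h + a then (1:ℝ) else 0)) with hf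
  have hlawM : ∀ k, h + a < k → ATOM4[a, h, m0, ma, mh, mt, k] = 0 := by
    intro k hk
    rw [if_neg (by omega), if_neg (by omega), if_neg (by omega), if_neg (by omega)]
    ring
  have hlaw1 : ∑ k ∈ Finset.range (h + a + 1), ATOM4[a, h, m0, ma, mh, mt, k] = 1 := by
    rw [Finset.sum_add_distrib, Finset.sum_add_distrib, Finset.sum_add_distrib,
      BlobDec2.sum_range_const_indicator _ 0 (Nat.zero_le _) m0, BlobDec2.sum_range_const_indicator _ a (Nat.le_add_left a h) ma,
      BlobDec2.sum_range_const_indicator _ h (Nat.le_add_right h a) mh, BlobDec2.sum_range_const_indicator _ (h + a) le_rfl mt]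
    exact hsum
  -- row values of the flow
  have hrow : ∀ l, ∑ k ∈ Finset.range (h + a + 1), f l k =
      (if l = 0 then (1:ℝ) else 0) * (F0h + F0t) + (if l = a then (1:ℝ) else 0) * (Fah + Fat) := by
    intro l
    have e : ∀ k, f l k = ((if l = 0 then (1:ℝ) else 0) * F0h + (if l = a then (1:ℝ) else 0) * Fah) * (if k = h then (1:ℝ) else 0)
        + ((if l = 0 then (1:ℝ) else 0) * F0t + (if l = a then (1:ℝ) else 0) * Fat) * (if k = h + a then (1:ℝ) else 0) := by
      intro k; simp only [hf]; ring
    simp only [e, Finset.sum_add_distrib]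
    rw [BlobDec2.sum_range_const_indicator _ h (Nat.le_add_right h a), BlobDec2.sum_range_const_indicator _ (h + a) le_rfl]
    ring
  -- column values of the loads
  have hcol : ∀ k, ∑ l ∈ Finset.range (j + 1), usage y t j l k * f l k =
      usage y t j 0 k * (F0h * (if k = h then (1:ℝ) else 0) + F0t * (if k = h + a then (1:ℝ) else 0))
        + usage y t j a k * (Fah * (if k = h then (1:ℝ) else 0) + Fat * (if k = h + a then (1:ℝ) else 0)) := by
    intro k
    have e : ∀ l, usage y t j l k * f l k =
        (usage y t j 0 k * (F0h * (if k = h then (1:ℝ) else 0) + F0t * (if k = h + a then (1:ℝ) else 0))) * (if l = 0 then (1:ℝ) else 0)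
        + (usage y t j a k * (Fah * (if k = h then (1:ℝ) else 0) + Fat * (if k = h + a then (1:ℝ) else 0))) * (if l = a then (1:ℝ) else 0) := by
      intro l; simp only [hf]
      by_cases hl0 : l = 0
      · rw [if_pos hl0, if_neg (by omega : l ≠ a), hl0]; ring
      · rw [if_neg hl0]
        by_cases hla : l = a
        · rw [if_pos hla, hla]; ring
        · rw [if_neg hla]; ring
    simp only [e, Finset.sum_add_distrib]
    rw [BlobDec2.sum_range_const_indicator _ 0 (Nat.zero_le _), BlobDec2.sum_range_const_indicator _ a haj]
  refine decAtT_of_flowAtT y t j (h + a) _ hy0 hy1 hlawM hlaw1 ⟨f, ?_, ?_, ?_, ?_⟩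
  · -- nonnegativity
    intro l k
    simp only [hf]
    have h1 := mul_nonneg hF0h (ind_nn (k = h)); have h2 := mul_nonneg hF0t (ind_nn (k = h + a))
    have h3 := mul_nonneg hFah (ind_nn (k = h)); have h4 := mul_nonneg hFat (ind_nn (k = h + a))
    exact add_nonneg (mul_nonneg (ind_nn _) (by linarith)) (mul_nonneg (ind_nn _) (by linarith))
  · -- support
    intro l k hpos
    simp only [hf] at hpos
    by_cases hl0 : l = 0
    · rw [if_pos hl0, if_neg (by omega : l ≠ a), one_mul, zero_mul, add_zero] at hpos
      subst hl0
      by_cases hkh : k = h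
      · subst hkh
        rw [if_pos rfl, if_neg (by omega), mul_one, mul_zero, add_zero] at hpos
        refine ⟨Nat.zero_le _, by simpa using ht0, by omega, ?_⟩
        rcases hs0h hpos with hg | hc
        · exact Or.inl hg
        · exact Or.inr (by simpa using hc)
      · rw [if_neg hkh, mul_zero, zero_add] at hpos
        by_cases hkt : k = h + a
        · subst hkt
          rw [if_pos rfl, mul_one] at hpos
          refine ⟨Nat.zero_le _, by simpa using ht0, le_rfl, ?_⟩
          rcases hs0t hpos with hg | hc
          · exact Or.inl hg
          · refine Or.inr ?_; push_cast; simpa using hc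
        · rw [if_neg hkt, mul_zero] at hpos; exact absurd hpos (lt_irrefl 0)
    · rw [if_neg hl0, zero_mul, zero_add] at hpos
      by_cases hla : l = a
      · rw [if_pos hla, one_mul] at hpos
        subst hla
        by_cases hkh : k = h
        · subst hkh
          rw [if_pos rfl, if_neg (by omega), mul_one, mul_zero, add_zero] at hpos
          refine ⟨haj, halow, by omega, ?_⟩
          rcases hsah hpos with hg | hc
          · exact Or.inl hg
          · exact Or.inr hc
        · rw [if_neg hkh, mul_zero, zero_add] at hpos
          by_cases hkt : k = h + l
          · subst hkt
            rw [if_pos rfl, mul_one] at hpos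
            refine ⟨haj, halow, le_rfl, ?_⟩
            rcases hsat hpos with hg | hc
            · exact Or.inl hg
            · refine Or.inr ?_; push_cast; linarith
          · rw [if_neg hkt, mul_zero] at hpos; exact absurd hpos (lt_irrefl 0)
      · rw [if_neg hla, zero_mul] at hpos; exact absurd hpos (lt_irrefl 0)
  · -- rows: the low atoms are exactly `0` and `a`
    intro l hlj hlow
    rw [hrow l]
    change _ = ATOM4[a, h, m0, ma, mh, mt, l]
    have hlh : l ≠ h := by
      rintro rfl
      rcases hhS with h2 | hg
      · linarith
      · omega
    have hlt : l ≠ h + a := by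
      rintro rfl
      rcases hhS with h2 | hg
      · push_cast at hlow; linarith [(Nat.cast_nonneg a : (0:ℝ) ≤ a)]
      · omega
    rw [if_neg hlh, if_neg hlt]
    by_cases hl0 : l = 0
    · have hla : l ≠ a := by omega
      rw [if_pos hl0, if_neg hla, hrow0]
      ring
    · rw [if_neg hl0]
      by_cases hla : l = a
      · rw [if_pos hla, hrowa]
        ring
      · rw [if_neg hla]
        ring
  · -- columns: loads of `h` and `h + a`; no load elsewhere
    intro k hkM hself
    rw [hcol k]
    change _ ≤ ATOM4[a, h, m0, ma, mh, mt, k]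
    have hk0 : k ≠ 0 := by
      rintro rfl
      rcases hself with hg | h2
      · omega
      · simp at h2; linarith
    have hka : k ≠ a := by
      rintro rfl
      rcases hself with hg | h2
      · omega
      · linarith
    rw [if_neg hk0, if_neg hka]
    by_cases hkh : k = h
    · have hkt : k ≠ h + a := by omega
      rw [if_pos hkh, if_neg hkt]
      simp only [mul_one, mul_zero, add_zero, zero_add]
      rw [hkh]
      linarith [hloadh]
    · rw [if_neg hkh]
      by_cases hkt : k = h + a
      · rw [if_pos hkt]
        simp only [mul_one, mul_zero, zero_add, add_zero]
        rw [hkt]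
        linarith [hloadt]
      · rw [if_neg hkt]
        simp

/-! ### The closed form when both absorbers are mids: the breakpoint inequalities of the two-low greedy -/

/-- **THE TWO-LOW CELL IN CLOSED FORM (both absorbers mids, word `LLMM`).**  Law `Π` as above with `m ≥ 0` of total `1`; `1 ≤ a < h`, `2a < t ≤ 2h`,
`h + a ≤ j` (so `0`, `a` are low and `h`, `h + a` are mids), `t < a + h` (the low `a` is compatible with both mids — automatic in the PM⁻ setting — and
`0` with `h + a`; `0` is compatible with `h` iff `t < h`).  Write `U₀ₕ, U_ah, U₀ₜ, U_at` for the usage rates and `κ_h = U_ah/U₀ₕ` (`0` if `t ≥ h`).  The three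
BREAKPOINT INEQUALITIES of census-1's greedy (low `a` fills `h`, then `h + a`; low `0` takes what is left) — (kh) if `a` fits into `h`:
`m₀ ≤ (m_h/U_ah − m_a)κ_h + m_t/U₀ₜ`; (kt) if `a` stops in `h + a`: `m₀ ≤ (m_h/U_ah + m_t/U_at − m_a)·U_at/U₀ₜ`; (kG) if `a` does not fit: `m₀ + m_a ≤ m_h/U_ah + m_t/U_at`
— give the flow of `fourAtom_decAtT_twoLow_of_flow` via `LawDec.twoLow_greedy_flows`, hence `DECAtT y t j (h + a) Π`.  (With the Monge order `κ_h ≤ U_at/U₀ₜ`,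
`LawDec.usage_monge`, the three inequalities are also necessary — memo §3 (3.2); not proved here.) [this work] -/
theorem fourAtom_decAtT_twoLow_mids (y t m0 ma mh mt : ℝ) (j a h : ℕ) (hy0 : 0 < y) (hy1 : y < 1)
    (hm0 : 0 ≤ m0) (hma : 0 ≤ ma) (hmh : 0 ≤ mh) (hmt : 0 ≤ mt) (hsum : m0 + ma + mh + mt = 1)
    (ha : 1 ≤ a) (hah : a < h) (halow : 2 * (a : ℝ) < t) (hh2 : t ≤ 2 * (h : ℝ)) (htj : h + a ≤ j) (hcomp : t < (a : ℝ) + h)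
    (hkh : ma ≤ mh / usage y t j a h →
      m0 ≤ (mh / usage y t j a h - ma) * (if t < (h : ℝ) then usage y t j a h / usage y t j 0 h else 0) + mt / usage y t j 0 (h + a))
    (hkt : mh / usage y t j a h ≤ ma → ma ≤ mh / usage y t j a h + mt / usage y t j a (h + a) →
      m0 ≤ (mh / usage y t j a h + mt / usage y t j a (h + a) - ma) * (usage y t j a (h + a) / usage y t j 0 (h + a)))
    (hkG : mh / usage y t j a h + mt / usage y t j a (h + a) ≤ ma → m0 + ma ≤ mh / usage y t j a h + mt / usage y t j a (h + a)) :
    DECAtT y t j (h + a) (fun k => ATOM4[a, h, m0, ma, mh, mt, k]) := by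
  classical
  have haj : a ≤ j := by omega
  have hhj : h ≤ j := by omega
  have hu : 0 < y / (1 - y) := div_pos hy0 (by linarith)
  -- the four usage rates are positive
  have hlow0 : 2 * ((0 : ℕ) : ℝ) < t := by simp; linarith [(Nat.cast_nonneg a : (0:ℝ) ≤ a)]
  have hUah : 0 < usage y t j a h := usage_pos_of_compat y t j a h hy0 hy1 halow hah (Or.inr hcomp)
  have hUat : 0 < usage y t j a (h + a) :=
    usage_pos_of_compat y t j a (h + a) hy0 hy1 halow (by omega) (Or.inr (by push_cast; linarith [(Nat.cast_nonneg a : (0:ℝ) ≤ a)]))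
  have hU0t : 0 < usage y t j 0 (h + a) :=
    usage_pos_of_compat y t j 0 (h + a) hy0 hy1 hlow0 (by omega) (Or.inr (by push_cast; linarith [(Nat.cast_nonneg a : (0:ℝ) ≤ a)]))
  have hU0h : t < (h : ℝ) → 0 < usage y t j 0 h := fun hc =>
    usage_pos_of_compat y t j 0 h hy0 hy1 hlow0 (by omega) (Or.inr (by simpa using hc))
  -- census-1's two-low greedy: low 1 = atom 0, low 2 = atom a, A = h, B = h + a, C = dummy, empty pool
  obtain ⟨F₁A, F₁B, F₁C, R₁, F₂A, F₂B, F₂C, R₂, h1A, h1B, h1C, hR1, h2A, h2B, h2C, hR2, s1A, _s1B, s1C, _s2A, _s2B, s2C,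
      row1, row2, capA, capB, _capC, capG⟩ :=
    twoLow_greedy_flows m0 ma (y / (1 - y)) 0 mh mt 0 (usage y t j 0 h) (usage y t j a h) (usage y t j 0 (h + a))
      (usage y t j a (h + a)) 1 1 (mh / usage y t j a h) (mt / usage y t j 0 (h + a)) (mt / usage y t j a (h + a)) 0 0
      (if t < (h : ℝ) then usage y t j a h / usage y t j 0 h else 0) (usage y t j a (h + a) / usage y t j 0 (h + a)) 0
      (t < (h : ℝ)) True True True False False
      hm0 hma hu le_rfl hmh hmt le_rfl (div_nonneg hmh hUah.le) (div_nonneg hmt hU0t.le) (div_nonneg hmt hUat.le) le_rfl le_rfl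
      (fun _ => ⟨hUah, div_mul_cancel₀ _ hUah.ne'⟩) (fun hn => absurd trivial hn)
      (fun _ => ⟨hU0t, div_mul_cancel₀ _ hU0t.ne'⟩) (fun hn => absurd trivial hn)
      (fun _ => ⟨hUat, div_mul_cancel₀ _ hUat.ne'⟩) (fun hn => absurd trivial hn)
      (fun hf => hf.elim) (fun _ => rfl) (fun hf => hf.elim) (fun _ => rfl)
      (by split_ifs with hc
          · exact div_nonneg hUah.le (hU0h hc).le
          · exact le_rfl)
      (fun hc => by rw [if_pos hc, div_mul_cancel₀ _ (hU0h hc).ne']) (fun hc => by rw [if_neg hc])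
      (div_nonneg hUat.le hU0t.le) (fun _ => div_mul_cancel₀ _ hU0t.ne') (fun hn => absurd trivial hn)
      le_rfl (fun hf => hf.elim) (fun _ => rfl)
      (fun _ hfit => by have := hkh hfit; rw [zero_div]; linarith)
      (fun _ h1 h2 => by have := hkt h1 h2; rw [zero_div]; linarith)
      (fun hf => hf.elim)
      (fun hG => by have := hkG (by linarith); rw [zero_div]; linarith)
  -- the dummy column and the empty pool carry nothing
  have hF1C : F₁C = 0 := by
    by_contra hne; exact s1C (lt_of_le_of_ne h1C (Ne.symm hne))
  have hF2C : F₂C = 0 := by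
    by_contra hne; exact s2C (lt_of_le_of_ne h2C (Ne.symm hne))
  have hR : R₁ = 0 ∧ R₂ = 0 := by
    have : R₁ + R₂ ≤ 0 := by
      by_contra hpos
      push Not at hpos
      have := mul_pos hu hpos
      linarith
    constructor <;> linarith
  refine fourAtom_decAtT_twoLow_of_flow y t m0 ma mh mt F₁A F₁B F₂A F₂B j a h hy0 hy1 hsum ha hah haj halow (Or.inl hh2)
    h1A h1B h2A h2B (by rw [hF1C, hR.1] at row1; linarith) (by rw [hF2C, hR.2] at row2; linarith)
    (fun hp => Or.inr (s1A hp)) (fun _ => Or.inr (by linarith [(Nat.cast_nonneg a : (0:ℝ) ≤ a)]))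
    (fun _ => Or.inr hcomp) (fun _ => Or.inr (by linarith [(Nat.cast_nonneg a : (0:ℝ) ≤ a), (Nat.cast_nonneg h : (0:ℝ) ≤ h)]))
    (by linarith [capA]) (by linarith [capB])

/-! ### The closed form when the top is a giant -/

/-- **TWO-LOW CELL, `h` a mid and `h + a` a giant (word `LLMG`).**  `1 ≤ a < h ≤ j < h + a`, `2a < t ≤ 2h`, `t < a + h`; pool = the giant `h + a` at rate
`u_y = y/(1−y)` for both lows.  Breakpoints: (kh) `m_a ≤ m_h/U_ah → m₀ ≤ (m_h/U_ah − m_a)κ_h + m_t/u_y`; (kG) `m_h/U_ah ≤ m_a → m₀ + m_a ≤ m_h/U_ah + m_t/u_y`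
⟹ `DECAtT y t j (h + a) Π`. [this work] -/
theorem fourAtom_decAtT_twoLow_giantTop (y t m0 ma mh mt : ℝ) (j a h : ℕ) (hy0 : 0 < y) (hy1 : y < 1)
    (hm0 : 0 ≤ m0) (hma : 0 ≤ ma) (hmh : 0 ≤ mh) (hmt : 0 ≤ mt) (hsum : m0 + ma + mh + mt = 1)
    (ha : 1 ≤ a) (hah : a < h) (halow : 2 * (a : ℝ) < t) (hh2 : t ≤ 2 * (h : ℝ)) (hhj : h ≤ j) (hjt : j + 1 ≤ h + a) (hcomp : t < (a : ℝ) + h)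
    (hkh : ma ≤ mh / usage y t j a h →
      m0 ≤ (mh / usage y t j a h - ma) * (if t < (h : ℝ) then usage y t j a h / usage y t j 0 h else 0) + mt / (y / (1 - y)))
    (hkG : mh / usage y t j a h ≤ ma → m0 + ma ≤ mh / usage y t j a h + mt / (y / (1 - y))) :
    DECAtT y t j (h + a) (fun k => ATOM4[a, h, m0, ma, mh, mt, k]) := by
  classical
  have haj : a ≤ j := by omega
  have hu : 0 < y / (1 - y) := div_pos hy0 (by linarith)
  have hlow0 : 2 * ((0 : ℕ) : ℝ) < t := by simp; linarith [(Nat.cast_nonneg a : (0:ℝ) ≤ a)]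
  have hUah : 0 < usage y t j a h := usage_pos_of_compat y t j a h hy0 hy1 halow hah (Or.inr hcomp)
  have hU0h : t < (h : ℝ) → 0 < usage y t j 0 h := fun hc =>
    usage_pos_of_compat y t j 0 h hy0 hy1 hlow0 (by omega) (Or.inr (by simpa using hc))
  have hUt0 : usage y t j 0 (h + a) = y / (1 - y) := usage_giant_eq y t j 0 (h + a) hjt
  have hUta : usage y t j a (h + a) = y / (1 - y) := usage_giant_eq y t j a (h + a) hjt
  -- greedy: low 1 = atom 0, low 2 = atom a, A = h, B = C = dummy, pool = m_t
  obtain ⟨F₁A, F₁B, F₁C, R₁, F₂A, F₂B, F₂C, R₂, h1A, h1B, h1C, hR1, h2A, h2B, h2C, hR2, s1A, s1B, s1C, _s2A, s2B, s2C,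
      row1, row2, capA, _capB, _capC, capG⟩ :=
    twoLow_greedy_flows m0 ma (y / (1 - y)) mt mh 0 0 (usage y t j 0 h) (usage y t j a h) 1 1 1 1
      (mh / usage y t j a h) 0 0 0 0 (if t < (h : ℝ) then usage y t j a h / usage y t j 0 h else 0) 0 0
      (t < (h : ℝ)) True False False False False
      hm0 hma hu hmt hmh le_rfl le_rfl (div_nonneg hmh hUah.le) le_rfl le_rfl le_rfl le_rfl
      (fun _ => ⟨hUah, div_mul_cancel₀ _ hUah.ne'⟩) (fun hn => absurd trivial hn)
      (fun hf => hf.elim) (fun _ => rfl) (fun hf => hf.elim) (fun _ => rfl)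
      (fun hf => hf.elim) (fun _ => rfl) (fun hf => hf.elim) (fun _ => rfl)
      (by split_ifs with hc
          · exact div_nonneg hUah.le (hU0h hc).le
          · exact le_rfl)
      (fun hc => by rw [if_pos hc, div_mul_cancel₀ _ (hU0h hc).ne']) (fun hc => by rw [if_neg hc])
      le_rfl (fun hf => hf.elim) (fun _ => rfl) le_rfl (fun hf => hf.elim) (fun _ => rfl)
      (fun _ hfit => by have := hkh hfit; linarith)
      (fun hf => hf.elim) (fun hf => hf.elim)
      (fun hG => by have := hkG (by linarith); linarith)
  have hF1B : F₁B = 0 := by by_contra hne; exact s1B (lt_of_le_of_ne h1B (Ne.symm hne))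
  have hF1C : F₁C = 0 := by by_contra hne; exact s1C (lt_of_le_of_ne h1C (Ne.symm hne))
  have hF2B : F₂B = 0 := by by_contra hne; exact s2B (lt_of_le_of_ne h2B (Ne.symm hne))
  have hF2C : F₂C = 0 := by by_contra hne; exact s2C (lt_of_le_of_ne h2C (Ne.symm hne))
  refine fourAtom_decAtT_twoLow_of_flow y t m0 ma mh mt F₁A R₁ F₂A R₂ j a h hy0 hy1 hsum ha hah haj halow (Or.inl hh2)
    h1A hR1 h2A hR2 (by rw [hF1B, hF1C] at row1; linarith) (by rw [hF2B, hF2C] at row2; linarith)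
    (fun hp => Or.inr (s1A hp)) (fun _ => Or.inl hjt) (fun _ => Or.inr hcomp) (fun _ => Or.inl hjt)
    (by linarith [capA]) (by rw [hUt0, hUta]; linarith [capG])

/-- **TWO-LOW CELL, both absorbers giants (word `LLGG`).**  `1 ≤ a < h`, `j + 1 ≤ h`, `a ≤ j`, `2a < t`: the giants carry the two lows at the common rate
`u_y = y/(1−y)`, so `(y/(1−y))(m₀ + m_a) ≤ m_h + m_t` ⟹ `DECAtT y t j (h + a) Π` (flows proportional to the giant masses). [this work] -/
theorem fourAtom_decAtT_twoLow_giants (y t m0 ma mh mt : ℝ) (j a h : ℕ) (hy0 : 0 < y) (hy1 : y < 1)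
    (hm0 : 0 ≤ m0) (hma : 0 ≤ ma) (hmh : 0 ≤ mh) (hmt : 0 ≤ mt) (hsum : m0 + ma + mh + mt = 1)
    (ha : 1 ≤ a) (hah : a < h) (haj : a ≤ j) (halow : 2 * (a : ℝ) < t) (hhg : j + 1 ≤ h)
    (hcap : y / (1 - y) * (m0 + ma) ≤ mh + mt) :
    DECAtT y t j (h + a) (fun k => ATOM4[a, h, m0, ma, mh, mt, k]) := by
  classical
  have hu : 0 < y / (1 - y) := div_pos hy0 (by linarith)
  have hjt : j + 1 ≤ h + a := by omega
  have hU0h : usage y t j 0 h = y / (1 - y) := usage_giant_eq y t j 0 h hhg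
  have hUah : usage y t j a h = y / (1 - y) := usage_giant_eq y t j a h hhg
  have hUt0 : usage y t j 0 (h + a) = y / (1 - y) := usage_giant_eq y t j 0 (h + a) hjt
  have hUta : usage y t j a (h + a) = y / (1 - y) := usage_giant_eq y t j a (h + a) hjt
  have hG : 0 < mh + mt := by
    by_contra hle
    push Not at hle
    have h0 : m0 + ma ≤ 0 := by
      by_contra hp; push Not at hp
      have := mul_pos hu hp
      linarith
    linarith
  set φ : ℝ := mh / (mh + mt) with hφ
  have hφ0 : 0 ≤ φ := div_nonneg hmh hG.le
  have hφ1 : φ ≤ 1 := (div_le_one hG).2 (by linarith)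
  have e1 : 1 - φ = mt / (mh + mt) := by rw [hφ]; field_simp; ring
  refine fourAtom_decAtT_twoLow_of_flow y t m0 ma mh mt (m0 * φ) (m0 * (1 - φ)) (ma * φ) (ma * (1 - φ)) j a h hy0 hy1 hsum ha hah haj
    halow (Or.inr hhg) (mul_nonneg hm0 hφ0) (mul_nonneg hm0 (by linarith)) (mul_nonneg hma hφ0) (mul_nonneg hma (by linarith))
    (by ring) (by ring) (fun _ => Or.inl hhg) (fun _ => Or.inl hjt) (fun _ => Or.inl hhg) (fun _ => Or.inl hjt) ?_ ?_
  · rw [hU0h, hUah, hφ]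
    have : y / (1 - y) * (m0 * (mh / (mh + mt))) + y / (1 - y) * (ma * (mh / (mh + mt)))
        = (y / (1 - y) * (m0 + ma)) * mh / (mh + mt) := by ring
    rw [this, div_le_iff₀ hG]
    nlinarith
  · rw [hUt0, hUta, e1]
    have : y / (1 - y) * (m0 * (mt / (mh + mt))) + y / (1 - y) * (ma * (mt / (mh + mt)))
        = (y / (1 - y) * (m0 + ma)) * mt / (mh + mt) := by ring
    rw [this, div_le_iff₀ hG]
    nlinarith

end LawDec

end Quant

end Summit.CriticalPhenomena.PercolationContinuityZ3.Theorems
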